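import Summits.ABC.IUTFork.LDHWitnessEstimate
import Summits.ABC.IUTFork.LanaEtaAlgorithm
import Summits.ABC.IUTFork.LanaLogLinkFrobeniusColumn
import Summits.ABC.IUTFork.Thm311LinkGlue
import HarnessLib

/-!
# F6 kernel decisions for the IUTFork FACT rows, middle of the file list (D-0079 L-F sub-cell F6): L-DH orbits and estimate, LANA's `η`-steps and log-Kummer column, Thm 3.11 (iii) link data

PROOF-ONLY companion (no `def`, no `structure`, no `instance`; nothing restated) deciding, in the kernel, the
eight `Summits/ABC/IUTFork` rows of `plan/L6/F6-START-HERE.tsv` in the four two-row files where the top-down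
and bottom-up F6 passes meet — `LDHCor312.lean` (F-1906 `DHData.IndRel`, F-2278 `DHData.EstimateDH`;
abc-iut-c312-3, Dupuy–Hilado level [cite: DupuyHilado2025, §4.7–4.12]), `LanaEtaAlgorithm.lean` (F-1907
`EtaSteps.Factors`, F-1908 `EtaSteps.KummerImageEq`; abc-iut-c312-4, [cite: LANA2026Report, §6.2 pp. 34–36,
§9.1 (f) p. 45]), `LanaLogKummer.lean` (F-1909 `LogKummerColumn.Commutes`, F-2217
`LogKummerColumn.UpperSemiCompatible`; [cite: LANA2026Report, §7.2 (b),(c) pp. 38–40]) and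
`Thm311LinkCompat.lean` (F-2059 `Thm311.PolyIsoCalc.SqCommutes`, F-2086 `Thm311.LinkData.PartIIId`;
abc-iut-c312-1, [IUTchIII] Thm. 3.11 (iii) [claim: Mochizuki2012, status: disputed]). Each is a `Prop`-valued
PREDICATE with parameters; abc-iut-w5-d145's kernel cross-reference (`F6-IUTFORK-XREF.tsv`, 5974af28adc2d03a)
found POSITIVE kernel witnesses at genuine/generic instances for F-1906, F-2217, F-2059, F-2086 (and both
truth values for F-2278), a toy witness for F-1908, refutations at the genuine `p`-adic column for F-1909, and
only conditional closers for F-1907. This file adds ONLY the missing halves, so that every row reads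
«per-datum predicate: universal closure FALSE (explicit structure), satisfiable TRUE (cited or explicit
instance)»:

* UNIVERSAL CLOSURE refuted: `DHData.not_forall_indRel` (two regions of DIFFERENT log-volume in c312-3's
  shell witness over `ℚ` are not (Ind1)/(Ind2)-related — log-volume is constant on orbits) and, at EVERY
  datum, `DHData.not_indRel_regionΘ_regionq` (the Θ- and `q`-regions lie in different orbits; abc-iut-c312-4's
  offer by name, (AD) in orbit form),
  `DHData.not_forall_estimateDH` (cited: c312-3's `ValLine.not_estimateDH_shellWitness_zero`),
  `EtaSteps.not_forall_factors` / `not_forall_kummerImageEq` (c312-4's own `EtaSteps.obstructed`),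
  `LogKummerColumn.not_forall_commutes` (cited: the GENUINE `p`-adic column, `padicColumn_not_commutes` —
  print's "far from commutative"), `LogKummerColumn.not_forall_upperSemiCompatible` (a column with empty étale
  log-shell), `Thm311.PolyIsoCalc.not_forall_sqCommutes` and `Thm311.LinkData.not_forall_partIIId` (over
  L6-t3's witness groupoid `SingleObj ℤˣ`: the automorphism `−1` is not the identity);
* INSTANCE FORM: `DHData.exists_indRel` (every possible image is in the orbit of the bare region, c312-3),
  `exists_estimateDH` (cited), `EtaSteps.trivial_factors` / `trivial_kummerImageEq` (c312-4's `EtaSteps.trivial`),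
  `LogKummerColumn.exists_commutes` (a column with identity log-links — NOT print's column),
  `exists_upperSemiCompatible` (cited: `padicColumn_upperSemiCompatible`, genuine), `exists_sqCommutes` (cited:
  `sqCommutes_full`, the printed full-poly case), `exists_partIIId` (cited: `Checks.toyLinkJ_partIIId`).

HONEST FRAMING. Deciding a FACT row = OUR kernel check of OUR typed interface-level predicate; a `¬∀` by a
degenerate structure and an `∃` by another say NOTHING about print, take NO SIDE on [IUTchIII] Cor. 3.12, and
do not touch the status of [claim: Mochizuki2012, status: disputed]. typed ≠ proved; instantiated ≠ endorsed.
Seat abc-iut-w5-d095 (gen 6), 2026-08-26.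
-/

noncomputable section

namespace Summit.ABC

namespace IUTFork

open CategoryTheory
open Literature.IUT.HodgeTheaters (PolyIso)
open Literature.IUT.LogThetaLattice

/-! ## A. `LDHCor312.lean` (p405727) — F-1906 `DHData.IndRel`, F-2278 `DHData.EstimateDH` -/

/-- **F-1906** `DHData.IndRel` ("(Ind1)/(Ind2)-equivalent regions", [cite: DupuyHilado2025, §4.7, §4.9]),
universal closure REFUTED over `ℚ`: in abc-iut-c312-3's shell witness (`ValLine.shellWitness`, the (Ind3)-region
taken to be the whole log-shell) the bare region `O_𝕃(−P_Θ)` and the hull `hull(U_Θ)` have DIFFERENT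
log-volumes (`ValLine.not_estimateDH_shellWitness_zero`: `ln ν̄_𝕃(hull) = 0 > −deĝ̲_lgp(P_Θ)`), whereas `ln ν̄_𝕃`
is constant on orbits (`DHData.lnνL_eq_of_indRel`) — so they are not related. [folklore] -/
theorem DHData.not_forall_indRel : ¬ ∀ (D : DHData ℚ) (A B : D.M.Region), D.IndRel A B := by
  intro h
  obtain ⟨X, -⟩ := ValLine.exists_pilotData_rat
  refine ValLine.not_estimateDH_shellWitness_zero X ?_
  have heq := (ValLine.shellWitness X).lnνL_eq_of_indRel ((ValLine.shellWitness X).M.region_adm _)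
    (h (ValLine.shellWitness X) ((ValLine.shellWitness X).M.region (ValLine.shellWitness X).tΘ)
      ((ValLine.shellWitness X).M.hullUTheta (ValLine.shellWitness X).ind3))
  unfold DHData.EstimateDH DHData.negLogThetaDH
  rw [add_zero]
  exact le_of_eq heq

/-- **F-1906**, the NON-degenerate `¬`-half at EVERY Dupuy–Hilado datum (offered BY NAME by abc-iut-c312-4 g9,
STATUS 14:35:50Z, staging `OfferF1906IndRelGenuineNeg.lean` 1fb0c93b4136bdbd — taken verbatim, credit c312-4): the
bare Θ-region `O_𝕃(−P_Θ)` and the `q`-region `O_𝕃(−P_q)` are NOT in one (Ind1)/(Ind2)-orbit — `ln ν̄_𝕃` is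
orbit-constant (c312-3's `lnνL_eq_of_indRel`) but takes the values `−deĝ̲_lgp(P_Θ) < −deĝ̲(P_q)` on them (DH
Thm. 3.10.1 `lnνL_regionΘ`/`lnνL_regionq` + (Syp2) `ndeg_qPilot_lt_ndegLgp_thetaPilot`). This is the orbit form of
(AD) "`{q^{j²}} ↦ q` is … incompatible … with computing arithmetic degrees" [cite: Mochizuki2019Report, §12 p. 22 (AD)].
[cite: DupuyHilado2025, §4.7, §4.9, Thm. 3.10.1] -/
theorem DHData.not_indRel_regionΘ_regionq {F : Type} [Field F] [NumberField F] (D : DHData F) :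
    ¬ D.IndRel (D.M.region D.tΘ) (D.M.region D.tq) := by
  intro h
  have h1 := D.lnνL_eq_of_indRel (D.M.region_adm D.tΘ) h
  rw [D.lnνL_regionq, D.lnνL_regionΘ] at h1
  have h2 := D.ndeg_qPilot_lt_ndegLgp_thetaPilot
  linarith

/-- **F-1906**, instance form: the relation is inhabited at genuine data — every possible image
`U_Θ^{(g,σ)}` is in the orbit of `(O_𝕃(−P_Θ))^{Ind3}` (abc-iut-c312-3's `DHData.indRel_bare3_UTheta`, for EVERY
`DHData`; here read at the shell witness over `ℚ` with the identity indeterminacies). [cite: DupuyHilado2025, §4.11] -/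
theorem DHData.exists_indRel : ∃ (D : DHData ℚ) (A B : D.M.Region), D.IndRel A B := by
  obtain ⟨X, -⟩ := ValLine.exists_pilotData_rat
  exact ⟨ValLine.shellWitness X, _, _,
    (ValLine.shellWitness X).indRel_bare3_UTheta (fun _ _ _ => 1, fun _ => 1)⟩

/-- **F-1906 decided**: closure false over `ℚ`; satisfiable; generic positive form = `indRel_bare3_UTheta`
(p405727); generic NEGATIVE form = `not_indRel_regionΘ_regionq` (every datum). [cite: DupuyHilado2025, §4.7–4.11] -/
theorem DHData.indRel_decision :
    (¬ ∀ (D : DHData ℚ) (A B : D.M.Region), D.IndRel A B) ∧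
      (∃ (D : DHData ℚ) (A B : D.M.Region), D.IndRel A B) ∧
        (∀ (F : Type) [Field F] [NumberField F] (D : DHData F) (lam : D.M.Ind2Elt × D.M.Ind1Elt),
          D.IndRel D.ind3.bare3 (D.M.UTheta D.ind3 lam)) ∧
        ∀ (F : Type) [Field F] [NumberField F] (D : DHData F), ¬ D.IndRel (D.M.region D.tΘ) (D.M.region D.tq) :=
  ⟨DHData.not_forall_indRel, DHData.exists_indRel, fun _ _ _ D lam => D.indRel_bare3_UTheta lam,
    fun _ _ _ D => D.not_indRel_regionΘ_regionq⟩

/-- **F-2278** `DHData.EstimateDH δ` (the multiradial estimate at the DH level, [IUTchIV] Thm. 1.10 Steps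
(iv)–(x) would supply `δ`), universal closure REFUTED over `ℚ` at `δ = 0` — CITED: abc-iut-c312-3's
`ValLine.not_estimateDH_shellWitness_zero` (p408701). [claim: Mochizuki2012, status: disputed] -/
theorem DHData.not_forall_estimateDH : ¬ ∀ (D : DHData ℚ) (δ : ℝ), D.EstimateDH δ := by
  obtain ⟨X, -⟩ := ValLine.exists_pilotData_rat
  exact fun h => ValLine.not_estimateDH_shellWitness_zero X (h _ 0)

/-- **F-2278**, instance form over `ℚ` at `δ = 0` — CITED: the bare witness of c312-3's
`estimateDH_independent_of_cor312DH` (p408701; genuine-data forms modulo [IUTchIV] Prop. 1.2 (ii):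
`DHData.estimateDH_ofTensor_of_sharp'`, `estimateDH_ofIdelesM`). [claim: Mochizuki2012, status: disputed] -/
theorem DHData.exists_estimateDH : ∃ D : DHData ℚ, D.EstimateDH 0 := by
  obtain ⟨⟨D, hD, -⟩, -⟩ := estimateDH_independent_of_cor312DH
  exact ⟨D, hD⟩

/-- **F-2278 decided**: closure false; satisfiable; both truth values over `ℚ` at `δ = 0`, each jointly with
the opposite truth value of (1.1) (`estimateDH_independent_of_cor312DH`). [claim: Mochizuki2012, status: disputed] -/
theorem DHData.estimateDH_decision :
    (¬ ∀ (D : DHData ℚ) (δ : ℝ), D.EstimateDH δ) ∧ (∃ D : DHData ℚ, D.EstimateDH 0) ∧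
      ∃ D : DHData ℚ, ¬ D.EstimateDH 0 := by
  obtain ⟨-, D, -, hD⟩ := estimateDH_independent_of_cor312DH
  exact ⟨DHData.not_forall_estimateDH, DHData.exists_estimateDH, D, hD⟩

/-! ## B. `LanaEtaAlgorithm.lean` (p404920) — F-1907 `EtaSteps.Factors`, F-1908 `EtaSteps.KummerImageEq` -/

/-- **F-1907** `EtaSteps.Factors` (§9.1 (f) p. 45: "the map from `M_∞` … actually factors through this
`∏_t O^▷_{v,t}`"), universal closure REFUTED by abc-iut-c312-4's own `EtaSteps.obstructed` (theta monoid `ℤ`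
mapping identically to `∞H¹ = ℤ`, `O^▷_{v,t}` trivial): a factorisation would give the containment
(`containment_of_factors`), which fails there (`EtaSteps.not_containment_obstructed`).
[cite: LANA2026Report, §9.1 (f) p. 45] -/
theorem EtaSteps.not_forall_factors : ¬ ∀ A : EtaSteps, A.Factors :=
  fun h => EtaSteps.not_containment_obstructed (EtaSteps.obstructed.containment_of_factors (h _))

/-- **F-1907**, instance form: in c312-4's trivial signature (all groups trivial, one label) `ψ_v` factors
through `φ_v` — via `containment_iff_factors` (the Kummer maps of `PUnit` are injective) and
`EtaSteps.trivial_containment`. A typing check, not mathematics. [cite: LANA2026Report, §9.1 (f) p. 45] -/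
theorem EtaSteps.trivial_factors : EtaSteps.trivial.Factors :=
  (EtaSteps.trivial.containment_iff_factors fun _ _ _ _ => Subsingleton.elim (α := PUnit) _ _).mp
    EtaSteps.trivial_containment

/-- **F-1907 decided**: closure false; satisfiable; for all signatures with injective local Kummer maps
`Factors ⟺ Containment` (c312-4's `containment_iff_factors` — the row's condition G = Kummer-faithfulness, an
[FrdII]/[EtTh] FACT consumed by name). [cite: LANA2026Report, §6.2 (g) p. 36, §9.1 (f) p. 45] -/
theorem EtaSteps.factors_decision :
    (¬ ∀ A : EtaSteps, A.Factors) ∧ (∃ A : EtaSteps, A.Factors) ∧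
      ∀ A : EtaSteps, (∀ t, Function.Injective (A.kappa t)) → (A.Containment ↔ A.Factors) :=
  ⟨EtaSteps.not_forall_factors, ⟨_, EtaSteps.trivial_factors⟩, fun A hκ => A.containment_iff_factors hκ⟩

/-- **F-1908** `EtaSteps.KummerImageEq` (p. 34 "schematic shorthand": the Kummer image of `M^{Θ,Frob}_{v,∞}` IS
`O^×_v(Π_v)·∞θ(Π_v)`), universal closure REFUTED by c312-4's `EtaSteps.obstructed`: there the Kummer image is
all of `ℤ` while `O^×_v(Π_v)·∞θ(Π_v) = ⊥ ⊔ ⊥` is trivial (`1 ∈ ℤ`, written multiplicatively, is in the former,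
not the latter). [cite: LANA2026Report, §6.2 (d) p. 34] -/
theorem EtaSteps.not_forall_kummerImageEq : ¬ ∀ A : EtaSteps, A.KummerImageEq := by
  intro h
  have h1 : EtaSteps.obstructed.rgd (EtaSteps.obstructed.kum (Multiplicative.ofAdd (1 : ℤ))) ∈
      EtaSteps.obstructed.thetaMonoidEt :=
    EtaSteps.obstructed.rgd_kum_mem_thetaMonoidEt (h _) _
  have h2 : EtaSteps.obstructed.thetaMonoidEt = ⊥ := by
    show (⊥ : Submonoid (Multiplicative ℤ)) ⊔ ⊥ = ⊥
    exact sup_bot_eq _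
  rw [h2, Submonoid.mem_bot] at h1
  change Multiplicative.ofAdd (1 : ℤ) = 1 at h1
  exact absurd (congrArg Multiplicative.toAdd h1) (by decide)

/-- **F-1908**, instance form: in c312-4's trivial signature both sides are submonoids of `PUnit`, hence equal
(cf. the Kummer-side check witness `EtaLimSide.selfKummer_kummerImageEq` found by the cross-reference). A typing
check, not mathematics. [cite: LANA2026Report, §6.2 (d) p. 34] -/
theorem EtaSteps.trivial_kummerImageEq : EtaSteps.trivial.KummerImageEq :=
  SetLike.ext fun x => by
    constructor <;> intro _ <;>
      · rw [Subsingleton.elim (α := PUnit) x 1]; exact Submonoid.one_mem _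

/-- **F-1908 decided**: closure false; satisfiable; and under it every Kummer image lies in the étale-like theta
monoid (c312-4's `rgd_kum_mem_thetaMonoidEt`). [cite: LANA2026Report, §6.2 (d) p. 34] -/
theorem EtaSteps.kummerImageEq_decision :
    (¬ ∀ A : EtaSteps, A.KummerImageEq) ∧ (∃ A : EtaSteps, A.KummerImageEq) ∧
      ∀ A : EtaSteps, A.KummerImageEq → ∀ m, A.rgd (A.kum m) ∈ A.thetaMonoidEt :=
  ⟨EtaSteps.not_forall_kummerImageEq, ⟨_, EtaSteps.trivial_kummerImageEq⟩,
    fun A h m => A.rgd_kum_mem_thetaMonoidEt h m⟩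

/-! ## C. `LanaLogKummer.lean` (p405438) — F-1909 `LogKummerColumn.Commutes`, F-2217 `LogKummerColumn.UpperSemiCompatible` -/

/-- **F-1909** `LogKummerColumn.Commutes` (what FAILS, §7.2 (b) p. 38: "This diagram is far from commutative";
the fold records «universal-closure refuted»), the refuting structure CITED at the GENUINE instance: the
`ℚ_p` column (Iwasawa logarithm as log-link, identity Kummer maps) does not commute — abc-iut-c312-4's
`padicColumn_not_commutes` (p419738), i.e. print's own statement. [cite: LANA2026Report, §7.2 (b) p. 38] -/
theorem LogKummerColumn.not_forall_commutes : ¬ ∀ L : LogKummerColumn, L.Commutes := by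
  haveI : Fact (Nat.Prime 2) := ⟨Nat.prime_two⟩
  exact fun h => padicColumn_not_commutes 2 (h _)

/-- **F-1909**, instance form (satisfiability of the typed predicate ONLY — print's column does NOT commute):
a column all of whose carriers are one point commutes. [folklore] -/
theorem LogKummerColumn.exists_commutes : ∃ L : LogKummerColumn, L.Commutes :=
  ⟨⟨fun _ => PUnit, fun _ => Set.univ, fun _ _ => PUnit.unit, PUnit, Set.univ, fun _ _ => PUnit.unit⟩,
    fun _ _ => rfl⟩

/-- **F-1909 decided**: closure false (at the genuine `p`-adic column, every `p`); satisfiable (degenerate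
column); the print-faithful POSITIVE form of the row is F-2217 (upper semi-compatibility), next.
[cite: LANA2026Report, §7.2 (b),(c) pp. 38–40] -/
theorem LogKummerColumn.commutes_decision :
    (¬ ∀ L : LogKummerColumn, L.Commutes) ∧ (∃ L : LogKummerColumn, L.Commutes) ∧
      ∀ (p : ℕ) [Fact p.Prime], ¬ (padicColumn p).Commutes :=
  ⟨LogKummerColumn.not_forall_commutes, LogKummerColumn.exists_commutes, fun p _ => padicColumn_not_commutes p⟩

/-- **F-2217** `LogKummerColumn.UpperSemiCompatible` (§7.2 (c) p. 40: "even after undergoing a shift by the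
log-link, all required images remain within the log-shell"), universal closure REFUTED: the one-point column
whose étale log-shell is EMPTY but whose Frobenius-like log-shells are not — the unshifted Kummer image of `⁰I`
is nonempty, hence not inside `∅`. [folklore] -/
theorem LogKummerColumn.not_forall_upperSemiCompatible : ¬ ∀ L : LogKummerColumn, L.UpperSemiCompatible := by
  intro h
  let L0 : LogKummerColumn :=
    ⟨fun _ => PUnit, fun _ => Set.univ, fun _ _ => PUnit.unit, PUnit, ∅, fun _ _ => PUnit.unit⟩
  have h0 : L0.imageAfterShifts ((0 : ℤ), (0 : ℕ)) ⊆ L0.etI := LogKummerColumn.kmm_image_subset L0 (h L0) 0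
  have hmem : (PUnit.unit : PUnit) ∈ L0.imageAfterShifts ((0 : ℤ), (0 : ℕ)) :=
    ⟨PUnit.unit, ⟨PUnit.unit, Set.mem_univ _, Subsingleton.elim _ _⟩, Subsingleton.elim _ _⟩
  exact (Set.mem_empty_iff_false _).mp (h0 hmem)

/-- **F-2217**, instance form at the GENUINE instance — CITED: the `ℚ_p` column is upper semi-compatible
(abc-iut-c312-4's `padicColumn_upperSemiCompatible`, p419738; also `realColumn_upperSemiCompatible`).
[cite: LANA2026Report, §7.2 (c) p. 40] -/
theorem LogKummerColumn.exists_upperSemiCompatible : ∃ L : LogKummerColumn, L.UpperSemiCompatible := by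
  haveI : Fact (Nat.Prime 2) := ⟨Nat.prime_two⟩
  exact ⟨padicColumn 2, padicColumn_upperSemiCompatible 2⟩

/-- **F-2217 decided**: closure false; PROVED at the genuine `p`-adic column for every prime `p`.
[cite: LANA2026Report, §7.2 (c) p. 40] -/
theorem LogKummerColumn.upperSemiCompatible_decision :
    (¬ ∀ L : LogKummerColumn, L.UpperSemiCompatible) ∧ (∃ L : LogKummerColumn, L.UpperSemiCompatible) ∧
      ∀ (p : ℕ) [Fact p.Prime], (padicColumn p).UpperSemiCompatible :=
  ⟨LogKummerColumn.not_forall_upperSemiCompatible, LogKummerColumn.exists_upperSemiCompatible,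
    fun p _ => padicColumn_upperSemiCompatible p⟩

/-! ## D. `Thm311LinkCompat.lean` (p405363) — F-2059 `Thm311.PolyIsoCalc.SqCommutes`, F-2086 `Thm311.LinkData.PartIIId` -/

namespace Thm311

/-- **F-2059** `PolyIsoCalc.SqCommutes` (the square of poly-isomorphisms commutes as sets, [IUTchI] §0),
universal closure REFUTED over abc-iut-L6-t3's witness groupoid `SingleObj ℤˣ`: with both vertical sides the
identity, top `{id}` and bottom `{−1}` give `{id} ≠ {−1}` (`Witness.negIso_ne_refl`). (For FULL horizontal
poly-isomorphisms — the printed case — the square always commutes: c312-1's `sqCommutes_full`.) [folklore] -/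
theorem PolyIsoCalc.not_forall_sqCommutes :
    ¬ ∀ (top bot : PolyIso Witness.pt Witness.pt) (left right : Witness.pt ≅ Witness.pt),
      PolyIsoCalc.SqCommutes top bot left right := by
  intro h
  have h1 := h (PolyIsoCalc.single (Iso.refl _)) (PolyIsoCalc.single Witness.negIso) (Iso.refl _) (Iso.refl _)
  unfold PolyIsoCalc.SqCommutes PolyIsoCalc.single PolyIso.comp at h1
  rw [Set.image2_singleton, Set.image2_singleton, Iso.refl_trans, Iso.refl_trans] at h1
  have h2 : Witness.negIso ∈ ({Iso.refl Witness.pt} : Set (Witness.pt ≅ Witness.pt)) := by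
    rw [h1]; exact Set.mem_singleton _
  exact Witness.negIso_ne_refl (Set.mem_singleton_iff.mp h2)

/-- **F-2059**, instance form — CITED at the printed instance: squares of FULL poly-isomorphisms commute
relative to any vertical isomorphisms, in any category (c312-1's `PolyIsoCalc.sqCommutes_full`, p405363).
[claim: Mochizuki2012, status: disputed] -/
theorem PolyIsoCalc.exists_sqCommutes :
    ∃ (top bot : PolyIso Witness.pt Witness.pt) (left right : Witness.pt ≅ Witness.pt),
      PolyIsoCalc.SqCommutes top bot left right :=
  ⟨_, _, Iso.refl _, Witness.negIso, PolyIsoCalc.sqCommutes_full _ _⟩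

/-- **F-2059 decided**: closure false; PROVED for full poly-isomorphisms in every category.
[claim: Mochizuki2012, status: disputed] -/
theorem PolyIsoCalc.sqCommutes_decision :
    (¬ ∀ (top bot : PolyIso Witness.pt Witness.pt) (left right : Witness.pt ≅ Witness.pt),
        PolyIsoCalc.SqCommutes top bot left right) ∧
      ∀ {C : Type} [Category.{0} C] {A A' B B' : C} (left : A ≅ B) (right : A' ≅ B'),
        PolyIsoCalc.SqCommutes (PolyIso.full A A') (PolyIso.full B B') left right :=
  ⟨PolyIsoCalc.not_forall_sqCommutes, fun left right => PolyIsoCalc.sqCommutes_full left right⟩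

/-- **F-2086** `LinkData.PartIIId` (Thm. 3.11 (iii) (d): the permutation-symmetry poly-isomorphism of the
`κ`-sol/`∞κ` data is "stabilized … with respect to arbitrary automorphisms of the domain and codomain"),
universal closure REFUTED: link data over `SingleObj ℤˣ` (all objects the point, all structural isomorphisms
the identity — as in c312-1/J's `Checks.skewLink`) whose permutation poly-isomorphism is the SINGLE identity
while the automorphism of `^{0,m}HT` acts on the `κ`-data at line `0` by `−1` (and trivially at the other
lines): `(−1) ∘ id ∘ id = −1 ∉ {id}`. [claim: Mochizuki2012, status: disputed] -/
theorem LinkData.not_forall_partIIId : ¬ ∀ K : LinkData, K.PartIIId := by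
  intro h
  have hK := h
    { Strip := Witness.Pt, Fdelta := fun _ _ => Witness.pt, FdeltaD := fun _ => Witness.pt,
      kumDelta := fun _ _ => Iso.refl _, FenvD := fun _ => Witness.pt, natEnvD := fun _ => Iso.refl _,
      Rad := Witness.Pt, R := fun _ => Witness.pt, permR := fun _ => PolyIso.full _ _,
      Kap := Witness.Pt, Mk := fun _ => Witness.pt, permM := fun _ => PolyIsoCalc.single (Iso.refl _),
      AutHT := fun _ _ => Unit, onDelta := fun _ _ _ => Iso.refl _, onDeltaD := fun _ _ _ => Iso.refl _,
      onR := fun _ _ _ => Iso.refl _,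
      onM := fun n _ _ => if n = 0 then Witness.negIso else Iso.refl _ }
  have h00 := hK 0 0 Witness.negIso ⟨(), by simp⟩ (Iso.refl Witness.pt) ⟨(), by simp⟩ (Iso.refl Witness.pt) rfl
  change Witness.negIso ≪≫ Iso.refl Witness.pt ≪≫ Iso.refl Witness.pt ∈
    ({Iso.refl Witness.pt} : Set (Witness.pt ≅ Witness.pt)) at h00
  rw [Iso.trans_refl, Iso.trans_refl] at h00
  exact Witness.negIso_ne_refl (Set.mem_singleton_iff.mp h00)

/-- **F-2086**, instance form — CITED: c312-1/J's toy link data built functorially (`Checks.toyLinkJ_partIIId`,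
p409130); generic positive forms `LinkData.ofFunctors_partIIId` / `ofBiCoric_partIIId` (p408087).
[claim: Mochizuki2012, status: disputed] -/
theorem LinkData.exists_partIIId : ∃ K : LinkData, K.PartIIId := ⟨Checks.toyLinkJ, Checks.toyLinkJ_partIIId⟩

/-- **F-2086 decided**: closure false; satisfiable (functorial link data). [claim: Mochizuki2012, status: disputed] -/
theorem LinkData.partIIId_decision : (¬ ∀ K : LinkData, K.PartIIId) ∧ ∃ K : LinkData, K.PartIIId :=
  ⟨LinkData.not_forall_partIIId, LinkData.exists_partIIId⟩

end Thm311

end IUTFork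

end Summit.ABC

end
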